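import Mathlib
import Summits.ResolutionOfSingularities.ResolutionOfSingularities.Theorems.HomologicalConductorGlobalisationK51CaPullback
import Literature.RingTheory.CohomologyAnnihilator.SyzygyBaseChange
import HarnessLib

/-!
# [OURS · LADDER-RESOLUTION L1 · slot W5.1 · kill test K5.1b continuation] Twisted pull-back of
# cohomology annihilators: `a·t ∈ caⁿ⁺¹(B) ⟹ a ∈ caⁿ⁺¹(A)` when `B` is `A`-projective and `t` has an
# `A`-linear coordinate `λ` with `λ(t) = 1`

Supports the host item `Globalisation` stmt-ResolutionOfSingularities-16486 (route `HomologicalConductor`)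
through OUR statement `CaLocalAtClosedPoints` (`Theorems/HomologicalConductorGlobalisationK51ClosedPointLocality`);
nothing here is a statement of the manuscript under adjudication in cell res-hironaka and nothing is
attributed to its author. Report: cell res-hironaka, `L/res-L1-k51/KILL-TEST-K5.1-k51.md` §11 ((S3⁺), (∗∗),
Theorem C).

**The lemma (OURS).** Let `A → B` be commutative rings, `A` and `B` noetherian, `B` projective (hence flat)
as an `A`-module, `λ : B → A` an `A`-linear map and `t ∈ B` with `λ t = 1`. If `a ∈ A` and
`(algebraMap a) * t ∈ caⁿ⁺¹(B)`, then `a ∈ caⁿ⁺¹(A)` (`mem_cohomologyAnnihilatorOfDegree_of_mul_mem`); the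
same for `ca` (`mem_cohomologyAnnihilator_of_mul_mem`). For `t = 1` this is the pull-back lemma of
`…K51CaPullback` (there proved through the retract `M → (B ⊗ M)|_A → M`; here through base change of
syzygies).

Proof. Let `M′`, `N` be finitely generated `A`-modules and `K′ = Ωⁿ_A M′`. By flat base change
`K := B ⊗_A K′ = Ωⁿ_B (B ⊗_A M′)` (tree `IsSyzygy.baseChange`), so `c := (algebraMap a)·t ∈ caⁿ⁺¹(B)` kills
the class of a presentation `0 → K₁ → Bᵐ → K → 0` (injective dimension shifting from `Extⁿ⁺¹_B`) and
`c • 𝟙_K = ψ ≫ g` lifts through `Bᵐ`. Over `A`, with `incl : K′ → K|_A`, `k ↦ 1 ⊗ k` and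
`proj : K|_A → K′`, `b ⊗ k ↦ λ(b)·k`, one has `proj ∘ (c • 𝟙_K) ∘ incl = a • 𝟙_{K′}`
(`λ((algebraMap a) t) = a λ(t) = a`), so `a • 𝟙_{K′}` factors through `Bᵐ|_A`, whose higher `Ext` over
`A` vanish (`K51CaPullback.ext_restrictScalars_eq_zero_of_projective`); hence `a` kills `Ext^{≥1}_A(K′, −)`
and, climbing the syzygy sequences over `A` (tree `mem_extAnnihilatorFrom_of_isSyzygy`),
`Ext^{≥ n+1}_A(M′, −)`. ∎

**Use ((∗∗) of the report).** `R = A₀[z]_{(𝔫,z)}` is free over `R′ = A₀[z^m]_{(𝔫,z^m)} ≅ R` with basis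
`1, z, …, z^{m−1}`; with `λ` = the `zʲ`-coordinate (`j < m`) and `t = zʲ`: `a zʲ ∈ caⁿ⁺¹(R) ⟹ a ∈ caⁿ⁺¹(R′)`,
and transporting along `R′ ≅ R` (tree `ringEquiv_apply_mem_cohomologyAnnihilatorOfDegree`), `a ∈ caⁿ⁺¹(R)`.
So `{a ∈ A₀ : a zʲ ∈ ca(R)}` does not depend on `j`, which with the `z`-homogeneity of `ca(R) ∩ A₀[z]`
(dilations) proves closed-point locality of `ca` on cylinders over isolated singularities (Theorem C of
the report, §11).

## References
* S. B. Iyengar, R. Takahashi, *Annihilation of cohomology and strong generation of module categories*,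
  IMRN 2016 (arXiv:1404.1476), §2. [IyengarTakahashi2014]
-/

set_option linter.dupNamespace false
set_option autoImplicit false

noncomputable section

open CategoryTheory CategoryTheory.Abelian CategoryTheory.Limits
open Literature.RingTheory.CohomologyAnnihilator
open Summit.ResolutionOfSingularities.ResolutionOfSingularities.Theorems.K51CaPullback
open scoped TensorProduct

universe u

namespace Summit.ResolutionOfSingularities.ResolutionOfSingularities.Theorems.K51CaTwistedPullback

variable {A B : Type u} [CommRing A] [CommRing B] [Algebra A B]

/-- **Twisted stable annihilation of a base-changed syzygy.** With `K = B ⊗_A K′ = Ωⁿ_B(B ⊗_A M′)` and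
`c = (algebraMap a)·t ∈ caⁿ⁺¹(B)`, `λ t = 1`: `a` kills `Extʲ_A(K′, N)` for `j ≥ 1` and every `A`-module `N`
— `a • 𝟙_{K′} = proj ∘ (c • 𝟙_K)|_A ∘ incl` factors through `Bᵐ|_A`. [OURS · L1 W5.1; report §11 (S3⁺)] -/
theorem smul_ext_eq_zero_of_isSyzygy_baseChange [IsNoetherianRing B] [Module.Projective A B]
    [Module.Flat A B] (lam : B →ₗ[A] A) (t : B) (ht : lam t = 1) {a : A} {n : ℕ}
    (hc : algebraMap A B a * t ∈ cohomologyAnnihilatorOfDegree B (n + 1))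
    {M' K' : ModuleCat.{u} A} [Module.Finite A M'] [Module.Finite A K'] (hK' : IsSyzygy n M' K')
    (N : ModuleCat.{u} A) {j : ℕ} (hj : 1 ≤ j) (e : Ext.{u} K' N j) : a • e = 0 := by
  -- the base-changed syzygy over `B` and a presentation of it
  have hK : IsSyzygy n (ModuleCat.of B (B ⊗[A] M')) (ModuleCat.of B (B ⊗[A] K')) :=
    IsSyzygy.baseChange (A := A) (B := B) n hK'
  obtain ⟨m, f, hf⟩ := Module.Finite.exists_fin' B (B ⊗[A] K')
  have hS := LinearMap.shortExact_shortComplexKer hf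
  haveI : Module.Finite B (LinearMap.ker f) := Module.IsNoetherian.finite B _
  have hcls : (algebraMap A B a * t) • hS.extClass = 0 := by
    refine ext_smul_eq_zero_of_isSyzygy n hK (ModuleCat.of B (LinearMap.ker f)) 1 le_rfl
      (algebraMap A B a * t) (fun e' => ?_) hS.extClass
    exact smul_eq_zero_of_mem_cohomologyAnnihilatorOfDegree hc (by omega) e'
  obtain ⟨ψ, hψ⟩ := exists_comp_eq_smul_id_X₃_of_smul_extClass_eq_zero hS hcls
  -- the two `A`-linear maps `incl : K′ → K|_A` and `proj : K|_A → K′`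
  let RR := restrictScalarsFunctor A B
  let incl : K' ⟶ RR.obj f.shortComplexKer.X₃ :=
    ModuleCat.ofHom (Y := RR.obj f.shortComplexKer.X₃)
      { toFun := fun k => (1 : B) ⊗ₜ[A] k
        map_add' := fun k k' => TensorProduct.tmul_add (1 : B) k k'
        map_smul' := fun r k => by
          change ((1 : B) ⊗ₜ[A] (r • k) : B ⊗[A] K') = algebraMap A B r • ((1 : B) ⊗ₜ[A] k)
          rw [algebraMap_smul, TensorProduct.tmul_smul] }
  let p₀ : B ⊗[A] K' →ₗ[A] K' := (TensorProduct.lid A K').toLinearMap ∘ₗ lam.rTensor K'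
  have hp₀ : ∀ (b : B) (k : K'), p₀ (b ⊗ₜ[A] k) = lam b • k := fun b k => by
    change TensorProduct.lid A K' (lam.rTensor K' (b ⊗ₜ[A] k)) = lam b • k
    rw [LinearMap.rTensor_tmul, TensorProduct.lid_tmul]
  let proj : RR.obj f.shortComplexKer.X₃ ⟶ K' :=
    ModuleCat.ofHom (X := RR.obj f.shortComplexKer.X₃)
      { toFun := fun (x : B ⊗[A] K') => p₀ x
        map_add' := fun (x x' : B ⊗[A] K') => map_add p₀ x x'
        map_smul' := fun (r : A) (x : B ⊗[A] K') => by
          change p₀ (algebraMap A B r • x) = r • p₀ x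
          rw [algebraMap_smul, map_smul] }
  -- `a • 𝟙_{K′}` factors through `Bᵐ|_A`
  have hfac : (incl ≫ RR.map ψ) ≫ (RR.map f.shortComplexKer.g ≫ proj) = a • 𝟙 K' := by
    have h1 : (incl ≫ RR.map ψ) ≫ (RR.map f.shortComplexKer.g ≫ proj) =
        incl ≫ RR.map (ψ ≫ f.shortComplexKer.g) ≫ proj := by
      simp only [Functor.map_comp, Category.assoc]
    rw [h1, hψ]
    apply ModuleCat.hom_ext
    refine LinearMap.ext fun k => ?_
    change p₀ ((algebraMap A B a * t) • ((1 : B) ⊗ₜ[A] k)) = a • k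
    rw [TensorProduct.smul_tmul', smul_eq_mul, mul_one, hp₀, ← Algebra.smul_def, map_smul, ht,
      smul_eq_mul, mul_one]
  have hX₂ : ∀ e₂ : Ext.{u} (RR.obj f.shortComplexKer.X₂) N j, e₂ = 0 := by
    obtain ⟨j', rfl⟩ : ∃ j', j = j' + 1 := ⟨j - 1, by omega⟩
    intro e₂
    exact ext_restrictScalars_eq_zero_of_projective (ModuleCat.of B (Fin m → B))
      ((IsProjective.iff_projective (R := B) (Fin m → B)).mp inferInstance) N e₂
  have hae : a • e = (Ext.mk₀ (incl ≫ RR.map ψ)).comp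
      ((Ext.mk₀ (RR.map f.shortComplexKer.g ≫ proj)).comp e (zero_add j)) (zero_add j) := by
    rw [Ext.mk₀_comp_mk₀_assoc, hfac, Ext.mk₀_smul, Ext.smul_comp, Ext.mk₀_id_comp]
  have hz : (Ext.mk₀ (RR.map f.shortComplexKer.g ≫ proj)).comp e (zero_add j) = 0 := by
    rw [← Ext.mk₀_comp_mk₀_assoc]
    rw [hX₂ ((Ext.mk₀ (RR.map f.shortComplexKer.g)).comp ((Ext.mk₀ proj).comp e (zero_add j))
      (zero_add j))]
  rw [hae, hz, Ext.comp_zero]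

/-- **Twisted pull-back of `caⁿ⁺¹` (report §11 (S3⁺)).** Let `A → B` be commutative noetherian rings with
`B` projective as an `A`-module, `λ : B → A` `A`-linear and `t ∈ B` with `λ t = 1`. If
`(algebraMap a)·t ∈ caⁿ⁺¹(B)` then `a ∈ caⁿ⁺¹(A)`. [OURS · L1 W5.1] -/
theorem mem_cohomologyAnnihilatorOfDegree_of_mul_mem [IsNoetherianRing A] [IsNoetherianRing B]
    [Module.Projective A B] [Module.Flat A B] (lam : B →ₗ[A] A) (t : B) (ht : lam t = 1) {a : A}
    {n : ℕ} (hc : algebraMap A B a * t ∈ cohomologyAnnihilatorOfDegree B (n + 1)) :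
    a ∈ cohomologyAnnihilatorOfDegree A (n + 1) := by
  rw [mem_cohomologyAnnihilatorOfDegree_iff]
  intro i hi M' N hM' hN e
  obtain ⟨K', hK'fin, hK'⟩ := exists_isSyzygy M' n
  haveI := hK'fin
  have hmem : a ∈ extAnnihilatorFrom K' 1 := by
    rw [mem_extAnnihilatorFrom_iff]
    intro j hj N' _ e'
    exact smul_ext_eq_zero_of_isSyzygy_baseChange lam t ht hc hK' N' hj e'
  have hmem' := mem_extAnnihilatorFrom_of_isSyzygy n hK' hmem
  rw [mem_extAnnihilatorFrom_iff] at hmem'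
  exact hmem' i (by omega) N hN e

/-- **Twisted pull-back of the full cohomology annihilator:** under the same hypotheses,
`(algebraMap a)·t ∈ ca(B) ⟹ a ∈ ca(A)`. Applied to the free extension
`A₀[z^m]_{(𝔫,z^m)} ⊂ A₀[z]_{(𝔫,z)}` with `t = zʲ` (`j < m`) and `λ` the `zʲ`-coordinate, and transported back
along `A₀[z^m]_{(𝔫,z^m)} ≅ A₀[z]_{(𝔫,z)}`: `a·zʲ ∈ ca ⟹ a ∈ ca` — the residual implication (∗) of the
report §10.1, hence closed-point locality of `ca` on cylinders over isolated singularities (§11).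
[OURS · L1 W5.1] -/
theorem mem_cohomologyAnnihilator_of_mul_mem [IsNoetherianRing A] [IsNoetherianRing B]
    [Module.Projective A B] [Module.Flat A B] (lam : B →ₗ[A] A) (t : B) (ht : lam t = 1) {a : A}
    (hc : algebraMap A B a * t ∈ cohomologyAnnihilator B) : a ∈ cohomologyAnnihilator A := by
  rw [mem_cohomologyAnnihilator_iff] at hc
  obtain ⟨m, hm⟩ := hc
  have hm' : algebraMap A B a * t ∈ cohomologyAnnihilatorOfDegree B (m + 1) :=
    cohomologyAnnihilatorOfDegree_mono (Nat.le_succ m) hm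
  exact cohomologyAnnihilatorOfDegree_le (m + 1)
    (mem_cohomologyAnnihilatorOfDegree_of_mul_mem lam t ht hm')

end Summit.ResolutionOfSingularities.ResolutionOfSingularities.Theorems.K51CaTwistedPullback

end
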